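import Summits.QuantumFields.YangMills.Theorems.BalabanUVNodesK0V23Defs

/-!
# CRIT-1 g32 — CUT-2 JUNK ∕ SAME-WALL KERNEL for lens-2's workfile `LENS-2-Line-flow-gronwall-ttel.lean` (sha16 58a903686c327761) §18 ∕ §E
(crux K0⁷ `stmt-QuantumFields-20541`; cell rules (N) №403, (v) №407; CRITIC's SAME-WALL test).

WHAT THIS FILE KERNEL-CHECKS (nothing of Bałaban's is asserted; all objects are lens-2's OWN predicates, copied verbatim from the workfile §A ∕ §18):

* (A) LOGIC.  For ANY predicate `P : ℕ → Prop`, «full-memory step» `∀ n, (∀ j < n, P j) → P n` is EQUIVALENT to `∀ n, P n` (strong induction one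
  way, weakening the other).  So a full-memory step AT A UNIFORM CONSTANT is the wall itself, re-spelled.
* (B) WALL ⟹ STUB at EVERY gain `ρ ≥ 0`, with `σ₀ := E₀` (the wall's own constant) and `b₁ := 0`: for a monotone format, the k-uniform format
  `∀ n v ∈ Box γ n, Fmt n v E₀` gives `FmtStepMem γ Fmt ρ E₀ 0` — in particular at the BY-VALUE gain `ρ := 1/2`.  This is exactly the junk instance
  «σ₀ := sup» which the workfile header (:16–:18) says is «excluded by the by-value rate and the constants-before-the-radius quantifier order»; it is NOT
  excluded: the wall's constant is itself radius-uniform below thresholds in the §E quantifier order, and the gain multiplies a constant the junk ignores.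
* (C) STUB ⟹ WALL is lens-2's own Grönwall `fmt_uniform_of_stepMem` (copied).  Hence, in the EXACT §E quantifier shape (`∃ σ₀ b₁ t` per family BEFORE
  the radius, `BelowAt t`), `hstep` at gain ½ ⟺ the radius-uniform wall «∃ E₀ t, BelowAt t (∀ n v ∈ Box γ n, FmtAt F a₀ ε₂₉ γ n v E₀)» — theorem
  `stubStepMemHalf_iff_uniformWall`; and the gain is IRRELEVANT at statement level: the stub at gain ½ ⟺ the stub at gain 0 ⟺ at any ρ ∈ [0,1)
  (`stubStepMem_gain_irrelevant`).
* (D) Rule (N) is respected by these statements too: the toy `toyFmt1` of the workfile inhabits both sides (fired below), so nothing here is vacuous.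

READING (for the verdict line): as TYPED, lens-2's ONE stub `stub_fmtStepMem` is stub 2′'s wall N3a in its radius-UNIFORM-E₀ form (print's absolute E₀,
[I] Thm 3 p.264) — the by-value ½, the «full memory» and «first step included» are statement-level DECORATION; they describe print's PROOF architecture
([II] CMP 116 p.20–21: C₃ linear in E₀, «O(1)C₃ε₁ ≤ ½E₀ … unessential», «½E₀ instead of E₀», «absolute constant … we define ½E₀ as equal to this
constant» — verified on the held pages by CRIT-1 g32), not a proposition distinct from the wall.  A STEP statement distinct from the wall needs σ₀ NAMED
(print: the log Z^{(k)} absolute constant) with `E` ranging below the wall's constant — no tree carrier for log Z^{(k)} exists (Node00 `BackgroundActionOfRecord`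
header D-defB-2).  HONEST: typing facts about hypothesis shapes; K0⁷ NOT closed; NODE O not inhabited; the Yang–Mills mass gap (Clay) is NOT proved by any of this.
-/

namespace Summit.QuantumFields.YangMills.Cruxes.Record13SepCoPHInhabited.Crit1Cut2

open Literature.MathematicalPhysics.QuantumFieldTheory.Balaban1983to89
open Literature.MathematicalPhysics.QuantumFieldTheory.Balaban1983to89.FlowStep
open Literature.MathematicalPhysics.QuantumFieldTheory.Balaban1983to89.T4Continuum

noncomputable section

/-! ## §0  lens-2's predicates and lemmas, VERBATIM from the workfile (§A, §16 `HFmt`∕`FmtMono`, §18) -/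

theorem mem_box_iff {γ : ℝ} {k : ℕ} {v : Fin (k + 1) → ℝ} : v ∈ Box γ k ↔ ∀ i, 0 < v i ∧ v i ≤ γ := by
  simp [Box, Set.mem_Ioc]

theorem box_mono {γ γ' : ℝ} (hγ : γ ≤ γ') {k : ℕ} {v : Fin (k + 1) → ℝ} (h : v ∈ Box γ k) : v ∈ Box γ' k := by
  rw [mem_box_iff] at h ⊢
  exact fun i => ⟨(h i).1, (h i).2.trans hγ⟩

def restrictHist {n : ℕ} (v : Fin (n + 1) → ℝ) (j : ℕ) (h : j ≤ n) : Fin (j + 1) → ℝ := fun i => v ⟨i.1, by omega⟩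

theorem restrictHist_mem_box {γ : ℝ} {n : ℕ} {v : Fin (n + 1) → ℝ} (hv : v ∈ Box γ n) {j : ℕ} (h : j ≤ n) :
    restrictHist v j h ∈ Box γ j := by
  rw [mem_box_iff] at hv ⊢
  intro i
  exact hv ⟨i.1, by omega⟩

structure Thresholds where
  aS : ℝ
  εS : ℝ
  γS : ℝ
  aS_pos : 0 < aS
  εS_pos : 0 < εS
  γS_pos : 0 < γS

def BelowAt (t : Thresholds) (P : ℝ → ℝ → ℝ → Prop) : Prop :=
  ∀ a₀ ε₂₉ γ : ℝ, 0 < a₀ → a₀ ≤ t.aS → 0 < ε₂₉ → ε₂₉ ≤ t.εS → 0 < γ → γ ≤ t.γS → P a₀ ε₂₉ γ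

abbrev HFmt : Type := (k : ℕ) → (Fin (k + 1) → ℝ) → ℝ → Prop

def FmtMono (Fmt : HFmt) : Prop := ∀ (k : ℕ) (v : Fin (k + 1) → ℝ) (E E' : ℝ), E ≤ E' → Fmt k v E → Fmt k v E'

/-- lens-2 §18 verbatim. -/
def FmtStepMem (γbar : ℝ) (Fmt : HFmt) (ρ σ₀ b₁ : ℝ) : Prop :=
  ∀ (n : ℕ) (v : Fin (n + 1) → ℝ) (E : ℝ), v ∈ Box γbar n → 0 ≤ E →
    (∀ (j : ℕ) (hj : j < n), Fmt j (restrictHist v j hj.le) E) → Fmt n v (ρ * E + σ₀ + v (Fin.last n) * b₁)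

def memM (ρ σ₀ b₁ γ : ℝ) : ℝ := (σ₀ + γ * b₁) / (1 - ρ)

theorem memM_nonneg {ρ σ₀ b₁ γ : ℝ} (hρ : ρ < 1) (hσ₀ : 0 ≤ σ₀) (hb₁ : 0 ≤ b₁) (hγ : 0 ≤ γ) : 0 ≤ memM ρ σ₀ b₁ γ :=
  div_nonneg (by positivity) (by linarith)

theorem memM_step_le {ρ σ₀ b₁ γ g : ℝ} (hρ : ρ < 1) (hb₁ : 0 ≤ b₁) (hg : g ≤ γ) :
    ρ * memM ρ σ₀ b₁ γ + σ₀ + g * b₁ ≤ memM ρ σ₀ b₁ γ := by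
  have h1 : 0 < 1 - ρ := by linarith
  set M := memM ρ σ₀ b₁ γ with hM
  have hkey : M * (1 - ρ) = σ₀ + γ * b₁ := by rw [hM]; unfold memM; exact div_mul_cancel₀ _ (ne_of_gt h1)
  have hkey' : M - ρ * M = σ₀ + γ * b₁ := by rw [← hkey]; ring
  linarith [hkey', mul_le_mul_of_nonneg_right hg hb₁]

theorem memM_mono_γ {ρ σ₀ b₁ γ γ' : ℝ} (hρ : ρ < 1) (hb₁ : 0 ≤ b₁) (hγ : γ ≤ γ') : memM ρ σ₀ b₁ γ ≤ memM ρ σ₀ b₁ γ' := by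
  unfold memM
  exact div_le_div_of_nonneg_right (by nlinarith [mul_le_mul_of_nonneg_right hγ hb₁]) (by linarith)

/-- lens-2 §18 Grönwall verbatim (STUB ⟹ WALL). -/
theorem fmt_uniform_of_stepMem {γ γbar : ℝ} {Fmt : HFmt} {ρ σ₀ b₁ : ℝ} (hγ : 0 ≤ γ) (hγbar : γ ≤ γbar) (hρ : ρ < 1) (hσ₀ : 0 ≤ σ₀)
    (hb₁ : 0 ≤ b₁) (hmono : FmtMono Fmt) (hstep : FmtStepMem γbar Fmt ρ σ₀ b₁) :
    ∀ (n : ℕ) (v : Fin (n + 1) → ℝ), v ∈ Box γ n → Fmt n v (memM ρ σ₀ b₁ γ) := by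
  have hMnn : 0 ≤ memM ρ σ₀ b₁ γ := memM_nonneg hρ hσ₀ hb₁ hγ
  intro n
  induction n using Nat.strong_induction_on with
  | _ n ih =>
    intro v hv
    have hlast := (mem_box_iff.mp hv) (Fin.last n)
    have h := hstep n v _ (box_mono hγbar hv) hMnn
      (fun j hj => ih j hj (restrictHist v j hj.le) (restrictHist_mem_box hv hj.le))
    exact hmono _ _ _ _ (memM_step_le hρ hb₁ hlast.2) h

/-! ## §A  LOGIC: a full-memory step at a uniform constant IS the ∀-statement (strong induction ⟺ weakening) -/

/-- For ANY predicate on levels: «every level, given all earlier levels» ⟺ «every level». [folklore] -/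
theorem stepMem_iff_forall (P : ℕ → Prop) : (∀ n, (∀ j < n, P j) → P n) ↔ ∀ n, P n := by
  constructor
  · intro h n
    induction n using Nat.strong_induction_on with
    | _ n ih => exact h n ih
  · intro h n _
    exact h n

/-! ## §B  WALL ⟹ STUB at every gain, with the wall's own constant as σ₀ (the junk instance the header claims excluded) -/

/-- The k-uniform format with constant `E₀` gives lens-2's full-memory step at EVERY gain `ρ ≥ 0` with `σ₀ := E₀`, `b₁ := 0` — the memory hypothesis
and the gain are simply not used. [folklore] -/
theorem fmtStepMem_of_uniform {γ : ℝ} {Fmt : HFmt} {E₀ ρ : ℝ} (hρ : 0 ≤ ρ) (hmono : FmtMono Fmt)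
    (hwall : ∀ (n : ℕ) (v : Fin (n + 1) → ℝ), v ∈ Box γ n → Fmt n v E₀) : FmtStepMem γ Fmt ρ E₀ 0 := by
  intro n v E hv hE _
  have h := hwall n v hv
  refine hmono _ _ _ _ ?_ h
  have : 0 ≤ ρ * E := mul_nonneg hρ hE
  simp only [mul_zero, add_zero]
  linarith

/-- In particular at the BY-VALUE gain ½. [folklore] -/
theorem fmtStepMemHalf_of_uniform {γ : ℝ} {Fmt : HFmt} {E₀ : ℝ} (hmono : FmtMono Fmt)
    (hwall : ∀ (n : ℕ) (v : Fin (n + 1) → ℝ), v ∈ Box γ n → Fmt n v E₀) : FmtStepMem γ Fmt (1 / 2) E₀ 0 :=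
  fmtStepMem_of_uniform (by norm_num) hmono hwall

/-! ## §C  The §E-shaped equivalence: `hstep` of `lineEnd` (gain ½, constants per family BEFORE the radius) ⟺ the radius-UNIFORM wall -/

/-- lens-2's `lineEnd` hypothesis `hstep`, verbatim shape (FmtAt abstract). -/
def StubStepMemAt (FmtAt : T4Family → ℝ → ℝ → ℝ → HFmt) (ρ : ℝ) : Prop :=
  ∀ F : T4Family, ∃ σ₀ b₁ : ℝ, ∃ t : Thresholds, 0 ≤ σ₀ ∧ 0 ≤ b₁ ∧
    BelowAt t fun a₀ ε₂₉ γ => FmtStepMem γ (FmtAt F a₀ ε₂₉ γ) ρ σ₀ b₁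

/-- The WALL in the same quantifier shape: ONE constant `E₀` per family, BEFORE the radius (print's absolute `E₀`, [I] Thm 3 p.264), the k-uniform
format below thresholds — exactly what `lineEnd`'s `hRoad` consumes. -/
def UniformWallAt (FmtAt : T4Family → ℝ → ℝ → ℝ → HFmt) : Prop :=
  ∀ F : T4Family, ∃ E₀ : ℝ, ∃ t : Thresholds, 0 ≤ E₀ ∧
    BelowAt t fun a₀ ε₂₉ γ => ∀ (n : ℕ) (v : Fin (n + 1) → ℝ), v ∈ Box γ n → FmtAt F a₀ ε₂₉ γ n v E₀

/-- **STUB at any gain `ρ ∈ [0,1)` ⟹ WALL** (Grönwall + monotonicity; `E₀ := memM ρ σ₀ b₁ t.γS`). [folklore] -/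
theorem uniformWall_of_stubStepMem {FmtAt : T4Family → ℝ → ℝ → ℝ → HFmt} {ρ : ℝ} (hρ0 : 0 ≤ ρ) (hρ : ρ < 1)
    (hmono : ∀ F a₀ ε₂₉ γ, FmtMono (FmtAt F a₀ ε₂₉ γ)) (h : StubStepMemAt FmtAt ρ) : UniformWallAt FmtAt := by
  intro F
  obtain ⟨σ₀, b₁, t, hσ₀, hb₁, hs⟩ := h F
  refine ⟨memM ρ σ₀ b₁ t.γS, t, memM_nonneg hρ hσ₀ hb₁ t.γS_pos.le, ?_⟩
  intro a₀ ε₂₉ γ ha hale hε hεle hγ hγle n v hv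
  have hst := hs a₀ ε₂₉ γ ha hale hε hεle hγ hγle
  have h1 := fmt_uniform_of_stepMem hγ.le le_rfl hρ hσ₀ hb₁ (hmono F a₀ ε₂₉ γ) hst n v hv
  have _ := hρ0
  exact hmono F a₀ ε₂₉ γ _ _ _ _ (memM_mono_γ hρ hb₁ hγle) h1

/-- **WALL ⟹ STUB at any gain `ρ ≥ 0`** (`σ₀ := E₀`, `b₁ := 0`, same thresholds; memory and gain unused). [folklore] -/
theorem stubStepMem_of_uniformWall {FmtAt : T4Family → ℝ → ℝ → ℝ → HFmt} {ρ : ℝ} (hρ0 : 0 ≤ ρ)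
    (hmono : ∀ F a₀ ε₂₉ γ, FmtMono (FmtAt F a₀ ε₂₉ γ)) (h : UniformWallAt FmtAt) : StubStepMemAt FmtAt ρ := by
  intro F
  obtain ⟨E₀, t, hE₀, hw⟩ := h F
  exact ⟨E₀, 0, t, hE₀, le_rfl, fun a₀ ε₂₉ γ ha hale hε hεle hγ hγle =>
    fmtStepMem_of_uniform hρ0 (hmono F a₀ ε₂₉ γ) (hw a₀ ε₂₉ γ ha hale hε hεle hγ hγle)⟩

/-- **★ SAME-WALL: lens-2's ONE stub at the by-value gain ½ ⟺ the radius-uniform wall** (for monotone formats — `lineEnd`'s own `hmono`). [folklore] -/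
theorem stubStepMemHalf_iff_uniformWall {FmtAt : T4Family → ℝ → ℝ → ℝ → HFmt}
    (hmono : ∀ F a₀ ε₂₉ γ, FmtMono (FmtAt F a₀ ε₂₉ γ)) : StubStepMemAt FmtAt (1 / 2) ↔ UniformWallAt FmtAt :=
  ⟨uniformWall_of_stubStepMem (by norm_num) (by norm_num) hmono, stubStepMem_of_uniformWall (by norm_num) hmono⟩

/-- **★ THE GAIN IS STATEMENT-LEVEL DECORATION: the stub at gain ½ ⟺ the stub at gain 0 ⟺ the stub at ANY `ρ ∈ [0,1)`.** [folklore] -/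
theorem stubStepMem_gain_irrelevant {FmtAt : T4Family → ℝ → ℝ → ℝ → HFmt}
    (hmono : ∀ F a₀ ε₂₉ γ, FmtMono (FmtAt F a₀ ε₂₉ γ)) {ρ : ℝ} (hρ0 : 0 ≤ ρ) (hρ : ρ < 1) :
    StubStepMemAt FmtAt ρ ↔ StubStepMemAt FmtAt (1 / 2) :=
  ⟨fun h => stubStepMem_of_uniformWall (by norm_num) hmono (uniformWall_of_stubStepMem hρ0 hρ hmono h),
   fun h => stubStepMem_of_uniformWall hρ0 hmono (uniformWall_of_stubStepMem (by norm_num) (by norm_num) hmono h)⟩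

theorem stubStepMemHalf_iff_gainZero {FmtAt : T4Family → ℝ → ℝ → ℝ → HFmt}
    (hmono : ∀ F a₀ ε₂₉ γ, FmtMono (FmtAt F a₀ ε₂₉ γ)) : StubStepMemAt FmtAt (1 / 2) ↔ StubStepMemAt FmtAt 0 :=
  (stubStepMem_gain_irrelevant hmono le_rfl (by norm_num)).symm

/-! ## §D  Rule (N): lens-2's toy `toyFmt1` inhabits both sides (no vacuity in the equivalence's relata) -/

def toyFmt1 : HFmt := fun k v E => (1 / 4 : ℝ) * (1 / 2) ^ k + v (Fin.last k) ≤ E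

theorem toyFmt1_mono : FmtMono toyFmt1 := fun _ _ _ _ hE h => le_trans h hE

/-- The toy wall: constant `E₀ := 1/4 + γ` on the box of side `γ`. -/
theorem toyFmt1_wall (γ : ℝ) : ∀ (n : ℕ) (v : Fin (n + 1) → ℝ), v ∈ Box γ n → toyFmt1 n v (1 / 4 + γ) := by
  intro n v hv
  have hlast := ((mem_box_iff.mp hv) (Fin.last n)).2
  have hp : (1 / 2 : ℝ) ^ n ≤ 1 := pow_le_one₀ (by norm_num) (by norm_num)
  show (1 / 4 : ℝ) * (1 / 2) ^ n + v (Fin.last n) ≤ 1 / 4 + γ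
  nlinarith

/-- The junk instance fires on the toy: the wall's constant as `σ₀`, gain ½ unused. -/
example (γ : ℝ) : FmtStepMem γ toyFmt1 (1 / 2) (1 / 4 + γ) 0 := fmtStepMemHalf_of_uniform toyFmt1_mono (toyFmt1_wall γ)

def toyThr : Thresholds := ⟨1, 1, 1 / 4, one_pos, one_pos, by norm_num⟩

/-- The constant toy family of formats inhabits `UniformWallAt` … -/
theorem toy_uniformWall : UniformWallAt (fun _ _ _ _ => toyFmt1) :=
  fun _ => ⟨1 / 4 + 1 / 4, toyThr, by norm_num, fun _ _ γ _ _ _ _ _ hγle n v hv =>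
    toyFmt1_mono _ _ _ _ (by have hγ' : γ ≤ 1 / 4 := hγle; linarith) (toyFmt1_wall γ n v hv)⟩

/-- … hence `StubStepMemAt` at gain ½ (and at gain 0), by the equivalence — both relata inhabited. -/
example : StubStepMemAt (fun _ _ _ _ => toyFmt1) (1 / 2) := stubStepMem_of_uniformWall (by norm_num) (fun _ _ _ _ => toyFmt1_mono) toy_uniformWall
example : StubStepMemAt (fun _ _ _ _ => toyFmt1) 0 := stubStepMem_of_uniformWall le_rfl (fun _ _ _ _ => toyFmt1_mono) toy_uniformWall

end

end Summit.QuantumFields.YangMills.Cruxes.Record13SepCoPHInhabited.Crit1Cut2
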